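import Mathlib
import Summits.PneNP.PneNP.Theorems.CnfIdealGenLengthRankDefectRepresentationsLocalCapture

/-!
# Crux `RankDefectRepresentations` (stmt-PneNP-18923), line `rank-dehn-ladder`: AVERAGE QUADRANT CAPTURE (lead g16, registered stub
# `stub_averageCapture` of `Lines/rank_dehn_ladder.lean` RESHAPE 13; memo `Cruxes/RankDefectRepresentations/Lines/rank-dehn-ladder-g16.md` §1–§2)

For a two-family instance `D` (rows/columns coloured by `{0,1}^n × {0,1}^{n'}`, a cell visible iff both families' colours differ,
`doubleCut row col B B' D = Φ(B,B')` = the sum of the four rectangle ranks), g14's QUADRANT CAPTURE (`…QuadrantCapture.stub_quadrantCapture`,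
p703363) produces, at a GLOBAL maximiser `(B,B')` of `Φ`, one matrix of rank `≤ 17·Φ(B,B')` that agrees with `D` on every visible cell separated by
`B` (first family) or by `B'` (second family); `…LocalCapture.localCapture` (p703814) does the same at a LOCAL maximiser.  Here:

* `capture_with_slack` — at an ARBITRARY double cut `(B,B')`, GIVEN the one-family LOCAL CUT INEQUALITY (registered stub `stub_localCut`, W12, taken
  as the hypothesis `hLC`: every colour-labelled matrix is within rank `4μ(B) + Σ_i (μ(B △ {i}) − μ(B))` of a colour-block-diagonal one, for EVERY `B`),
  one matrix of rank `≤ 9·Φ(B,B') + Σ_i (Φ(B△{i},B') − Φ(B,B')) + Σ_j (Φ(B,B'△{j}) − Φ(B,B'))` (SIGNED slack terms) captures every visible cell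
  separated by `B` or by `B'`.  (The constant is `9 = 4 + 4 + 1`, not `17`: the two one-family completions need no re-masking, because the
  block-diagonal correctors vanish on visible cells.)
* `sum_symmDiff_singleton` — `B ↦ B △ {i}` permutes the power set, so `Σ_B f(B △ {i}) = Σ_B f(B)`: the slack terms CANCEL when summed over all cuts.
* `stub_averageCapture` — hence SOME double cut captures at rank `≤ 9 · avg_{A,A'} Φ(A,A')` (registered with the weaker constant `17`):
  `2^{2^n} · 2^{2^{n'}} · rank N ≤ 17 · Σ_{A,A'} Φ(A,A')`.

Why the line wants the AVERAGE double cut (memo §1): it is exactly additive over zero-cross halves and monotone under passing to quadrant / half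
sub-instances — the two properties whose failure for MAX budgets is the obstruction recorded by leads g14/g15 (adjacent budgets do not split).
HONEST FRAMING: a negative-lane tool conditional on the registered TRUE stub W12; `stub_merge` and the crux stay open; P ≠ NP is not moved; F-N2
is a FRONTIER formal rung.
-/

set_option linter.dupNamespace false -- `Summit.PneNP.PneNP.…`: summit = sub-problem name (D-0017)

namespace Summit.PneNP.PneNP.Theorems.CnfIdealGenLengthRankDefectRepresentationsAverageCapture

open Matrix Finset
open Summit.PneNP.PneNP.Theorems.CnfIdealGenLengthRankDefectRepresentationsMergeLowerBound (rank_add_le' rank_sub_le')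
open Summit.PneNP.PneNP.Theorems.CnfIdealGenLengthRankDefectRepresentationsTwoFamilyCutDomination (colourI colourJ maskJ doubleCut)
open Summit.PneNP.PneNP.Theorems.CnfIdealGenLengthRankDefectRepresentationsLocalCapture (bcut bcut_maskJ bcut_maskI)

variable {K : Type} [Field K]

/-! ## The involution `B ↦ B △ {i}` and the cancellation of signed slack -/

/-- `B ↦ B △ {i}` permutes the power set, so summing `f(B △ {i})` over all `B` is summing `f`. [folklore] -/
theorem sum_symmDiff_singleton {α M : Type} [DecidableEq α] [Fintype α] [AddCommMonoid M] (f : Finset α → M) (i : α) :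
    ∑ B : Finset α, f (symmDiff B {i}) = ∑ B : Finset α, f B :=
  Fintype.sum_equiv
    ⟨fun B => symmDiff B {i}, fun B => symmDiff B {i}, fun _ => symmDiff_symmDiff_cancel_right _ _,
      fun _ => symmDiff_symmDiff_cancel_right _ _⟩ _ _ (fun _ => rfl)

/-- The signed slack of a cut function cancels when summed over all cuts: `Σ_B Σ_i (f(B △ {i}) − f(B)) = 0`. [folklore] -/
theorem sum_sum_slack_eq_zero {α : Type} [DecidableEq α] [Fintype α] (f : Finset α → ℤ) :
    ∑ B : Finset α, ∑ i : α, (f (symmDiff B {i}) - f B) = 0 := by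
  rw [Finset.sum_comm]
  refine Finset.sum_eq_zero fun i _ => ?_
  rw [Finset.sum_sub_distrib, sum_symmDiff_singleton f i, sub_self]

/-! ## Capture at an arbitrary double cut, with signed slack -/

section Capture

variable {n n' : ℕ} {ι ι' : Type} [Fintype ι] [Fintype ι'] [DecidableEq ι] [DecidableEq ι']
variable (row : ι → Fin n ⊕ Fin n' → Bool) (col : ι' → Fin n ⊕ Fin n' → Bool)

/-- **CAPTURE AT AN ARBITRARY DOUBLE CUT, WITH SIGNED SLACK.**  Assume the one-family LOCAL CUT INEQUALITY (`hLC`, = registered stub `stub_localCut`).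
Then at every double cut `(B,B')` one matrix of rank `≤ 9Φ(B,B') + Σ_i (Φ(B△{i},B') − Φ(B,B')) + Σ_j (Φ(B,B'△{j}) − Φ(B,B'))` agrees with `D` on every
visible cell separated by `B` or by `B'`.  Proof: `hLC` for the `B'`-masked matrix with the first-family colouring (its bipartition cut at `A` is `Φ(A,B')`,
`bcut_maskJ`) gives `L₁` agreeing with `D` on the visible `B'`-separated cells and vanishing on the other visible cells; symmetrically `L₂` from the `B`-masked
matrix (`bcut_maskI`); `N := L₁ + L₂ − D ∘ 1[separated by both]`, the last term having rank `≤ Φ(B,B')`. -/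
theorem capture_with_slack
    (hLC : ∀ (K : Type) [Field K] (ι ι' Q : Type) [Fintype ι] [Fintype ι'] [DecidableEq ι] [DecidableEq ι'] [Fintype Q] [DecidableEq Q]
      (row : ι → Q) (col : ι' → Q) (R : Matrix ι ι' K) (B : Finset Q),
      ∃ R' : Matrix ι ι' K, (∀ x y, row x ≠ col y → R' x y = 0) ∧
        ((R - R').rank : ℤ) ≤
          4 * (((Matrix.of fun x y => if row x ∈ B ∧ col y ∉ B then R x y else 0).rank : ℤ) +
              ((Matrix.of fun x y => if row x ∉ B ∧ col y ∈ B then R x y else 0).rank : ℤ)) +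
          ∑ i : Q, ((((Matrix.of fun x y => if row x ∈ symmDiff B {i} ∧ col y ∉ symmDiff B {i} then R x y else 0).rank : ℤ) +
              ((Matrix.of fun x y => if row x ∉ symmDiff B {i} ∧ col y ∈ symmDiff B {i} then R x y else 0).rank : ℤ)) -
            (((Matrix.of fun x y => if row x ∈ B ∧ col y ∉ B then R x y else 0).rank : ℤ) +
              ((Matrix.of fun x y => if row x ∉ B ∧ col y ∈ B then R x y else 0).rank : ℤ))))
    (D : Matrix ι ι' K) (B : Finset (Fin n → Bool)) (B' : Finset (Fin n' → Bool)) :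
    ∃ N : Matrix ι ι' K,
      (N.rank : ℤ) ≤ 9 * (doubleCut row col B B' D : ℤ) +
          ∑ i : Fin n → Bool, ((doubleCut row col (symmDiff B {i}) B' D : ℤ) - (doubleCut row col B B' D : ℤ)) +
          ∑ j : Fin n' → Bool, ((doubleCut row col B (symmDiff B' {j}) D : ℤ) - (doubleCut row col B B' D : ℤ)) ∧
      ∀ x y, colourI (row x) ≠ colourI (col y) → colourJ (row x) ≠ colourJ (col y) →
        ((colourI (row x) ∈ B) ≠ (colourI (col y) ∈ B) ∨ (colourJ (row x) ∈ B') ≠ (colourJ (col y) ∈ B')) →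
        N x y = D x y := by
  classical
  -- (1) the `B'`-masked matrix, first-family coloured
  set M₁ : Matrix ι ι' K := maskJ row col B' D with hM₁
  have hb₁ : ∀ A : Finset (Fin n → Bool),
      ((Matrix.of fun x y => if colourI (row x) ∈ A ∧ colourI (col y) ∉ A then M₁ x y else 0).rank : ℤ) +
        ((Matrix.of fun x y => if colourI (row x) ∉ A ∧ colourI (col y) ∈ A then M₁ x y else 0).rank : ℤ) =
      (doubleCut row col A B' D : ℤ) := by
    intro A
    rw [← Nat.cast_add]
    exact congrArg Nat.cast (bcut_maskJ row col D A B')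
  obtain ⟨R₁, hR₁s, hR₁⟩ := hLC K ι ι' (Fin n → Bool) (fun x => colourI (row x)) (fun y => colourI (col y)) M₁ B
  simp only [hb₁] at hR₁
  -- (2) the `B`-masked matrix, second-family coloured
  set M₂ : Matrix ι ι' K := Matrix.of fun x y => if (colourI (row x) ∈ B) ≠ (colourI (col y) ∈ B) then D x y else 0 with hM₂
  have hb₂ : ∀ A' : Finset (Fin n' → Bool),
      ((Matrix.of fun x y => if colourJ (row x) ∈ A' ∧ colourJ (col y) ∉ A' then M₂ x y else 0).rank : ℤ) +
        ((Matrix.of fun x y => if colourJ (row x) ∉ A' ∧ colourJ (col y) ∈ A' then M₂ x y else 0).rank : ℤ) =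
      (doubleCut row col B A' D : ℤ) := by
    intro A'
    rw [← Nat.cast_add]
    exact congrArg Nat.cast (bcut_maskI row col D B A')
  obtain ⟨R₂, hR₂s, hR₂⟩ := hLC K ι ι' (Fin n' → Bool) (fun x => colourJ (row x)) (fun y => colourJ (col y)) M₂ B'
  simp only [hb₂] at hR₂
  -- (3) the doubly separated cells: the two first-family cut blocks of `M₁` at `B`, total rank `≤ Φ(B,B')`
  set N₃ : Matrix ι ι' K := Matrix.of fun x y => if (colourI (row x) ∈ B) ≠ (colourI (col y) ∈ B) then M₁ x y else 0 with hN₃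
  have hN₃r : (N₃.rank : ℤ) ≤ (doubleCut row col B B' D : ℤ) := by
    have e : N₃ = (Matrix.of fun x y => if colourI (row x) ∈ B ∧ colourI (col y) ∉ B then M₁ x y else 0) +
        (Matrix.of fun x y => if colourI (row x) ∉ B ∧ colourI (col y) ∈ B then M₁ x y else 0) := by
      ext x y
      simp only [hN₃, Matrix.of_apply, Matrix.add_apply]
      by_cases h1 : colourI (row x) ∈ B <;> by_cases h2 : colourI (col y) ∈ B <;> simp [h1, h2]
    rw [← hb₁ B, e]
    exact_mod_cast rank_add_le' _ _
  -- (4) assemble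
  refine ⟨(M₁ - R₁) + (M₂ - R₂) - N₃, ?_, ?_⟩
  · have r := rank_sub_le' ((M₁ - R₁) + (M₂ - R₂)) N₃
    have r' := rank_add_le' (M₁ - R₁) (M₂ - R₂)
    have r1 : (((M₁ - R₁) + (M₂ - R₂) - N₃).rank : ℤ) ≤ ((M₁ - R₁).rank : ℤ) + ((M₂ - R₂).rank : ℤ) + (N₃.rank : ℤ) := by
      exact_mod_cast r.trans (Nat.add_le_add_right r' _)
    linarith
  · intro x y hI hJ hsep
    have r1 : R₁ x y = 0 := hR₁s x y hI
    have r2 : R₂ x y = 0 := hR₂s x y hJ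
    have m1 : M₁ x y = if (colourJ (row x) ∈ B') ≠ (colourJ (col y) ∈ B') then D x y else 0 := rfl
    have m2 : M₂ x y = if (colourI (row x) ∈ B) ≠ (colourI (col y) ∈ B) then D x y else 0 := rfl
    have m3 : N₃ x y = if (colourI (row x) ∈ B) ≠ (colourI (col y) ∈ B) then M₁ x y else 0 := rfl
    simp only [Matrix.sub_apply, Matrix.add_apply, r1, r2, sub_zero, m3, m1, m2]
    by_cases h : (colourI (row x) ∈ B) ≠ (colourI (col y) ∈ B)
    · by_cases h' : (colourJ (row x) ∈ B') ≠ (colourJ (col y) ∈ B')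
      · simp [h, h']
      · simp [h, h']
    · by_cases h' : (colourJ (row x) ∈ B') ≠ (colourJ (col y) ∈ B')
      · simp [h, h']
      · exfalso
        rcases hsep with hs | hs
        · exact h hs
        · exact h' hs

end Capture

/-! ## The registered stub: AVERAGE QUADRANT CAPTURE -/

/-- Cardinality of the power set of the colour type `{0,1}^n`. -/
theorem card_finset_cube (n : ℕ) : Fintype.card (Finset (Fin n → Bool)) = 2 ^ (2 ^ n) := by
  rw [Fintype.card_finset, Fintype.card_fun, Fintype.card_bool, Fintype.card_fin]

/-- **AVERAGE QUADRANT CAPTURE** (registered stub `stub_averageCapture` of `Lines/rank_dehn_ladder.lean`, RESHAPE 13, lead g16).  Assuming the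
one-family local cut inequality (registered stub `stub_localCut`, W12), every two-family instance `D` admits a double cut `(B,B')` and ONE matrix `N`
with `2^{2^n} · 2^{2^{n'}} · rank N ≤ 17 · Σ_{A,A'} Φ(A,A')` — i.e. `rank N ≤ 17 · avg Φ` (in fact `9 · avg Φ`) — agreeing with `D` on every visible cell
separated by `B` or by `B'`.  Proof: sum `capture_with_slack` over all `(B,B')`; the signed slack terms cancel (`sum_sum_slack_eq_zero`); a pair of minimal
cost is at most average. -/
theorem stub_averageCapture :
    (∀ (K : Type) [Field K] (ι ι' Q : Type) [Fintype ι] [Fintype ι'] [DecidableEq ι] [DecidableEq ι'] [Fintype Q] [DecidableEq Q]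
      (row : ι → Q) (col : ι' → Q) (R : Matrix ι ι' K) (B : Finset Q),
      ∃ R' : Matrix ι ι' K, (∀ x y, row x ≠ col y → R' x y = 0) ∧
        ((R - R').rank : ℤ) ≤
          4 * (((Matrix.of fun x y => if row x ∈ B ∧ col y ∉ B then R x y else 0).rank : ℤ) +
              ((Matrix.of fun x y => if row x ∉ B ∧ col y ∈ B then R x y else 0).rank : ℤ)) +
          ∑ i : Q, ((((Matrix.of fun x y => if row x ∈ symmDiff B {i} ∧ col y ∉ symmDiff B {i} then R x y else 0).rank : ℤ) +
              ((Matrix.of fun x y => if row x ∉ symmDiff B {i} ∧ col y ∈ symmDiff B {i} then R x y else 0).rank : ℤ)) -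
            (((Matrix.of fun x y => if row x ∈ B ∧ col y ∉ B then R x y else 0).rank : ℤ) +
              ((Matrix.of fun x y => if row x ∉ B ∧ col y ∈ B then R x y else 0).rank : ℤ)))) →
    ∀ (K : Type) [Field K] (n n' : ℕ) (ι ι' : Type) [Fintype ι] [Fintype ι'] [DecidableEq ι] [DecidableEq ι']
      (row : ι → Fin n ⊕ Fin n' → Bool) (col : ι' → Fin n ⊕ Fin n' → Bool) (D : Matrix ι ι' K),
      ∃ (B : Finset (Fin n → Bool)) (B' : Finset (Fin n' → Bool)) (N : Matrix ι ι' K),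
        2 ^ (2 ^ n) * 2 ^ (2 ^ n') * N.rank ≤
          17 * ∑ A : Finset (Fin n → Bool), ∑ A' : Finset (Fin n' → Bool), Summit.PneNP.PneNP.Theorems.CnfIdealGenLengthRankDefectRepresentationsTwoFamilyCutDomination.doubleCut row col A A' D ∧
        ∀ x y,
          Summit.PneNP.PneNP.Theorems.CnfIdealGenLengthRankDefectRepresentationsTwoFamilyCutDomination.colourI (row x) ≠ Summit.PneNP.PneNP.Theorems.CnfIdealGenLengthRankDefectRepresentationsTwoFamilyCutDomination.colourI (col y) →
          Summit.PneNP.PneNP.Theorems.CnfIdealGenLengthRankDefectRepresentationsTwoFamilyCutDomination.colourJ (row x) ≠ Summit.PneNP.PneNP.Theorems.CnfIdealGenLengthRankDefectRepresentationsTwoFamilyCutDomination.colourJ (col y) →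
          ((Summit.PneNP.PneNP.Theorems.CnfIdealGenLengthRankDefectRepresentationsTwoFamilyCutDomination.colourI (row x) ∈ B) ≠ (Summit.PneNP.PneNP.Theorems.CnfIdealGenLengthRankDefectRepresentationsTwoFamilyCutDomination.colourI (col y) ∈ B) ∨
            (Summit.PneNP.PneNP.Theorems.CnfIdealGenLengthRankDefectRepresentationsTwoFamilyCutDomination.colourJ (row x) ∈ B') ≠ (Summit.PneNP.PneNP.Theorems.CnfIdealGenLengthRankDefectRepresentationsTwoFamilyCutDomination.colourJ (col y) ∈ B')) →
          N x y = D x y := by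
  intro hLC K _ n n' ι ι' _ _ _ _ row col D
  classical
  -- cut function and cost
  set φ : Finset (Fin n → Bool) → Finset (Fin n' → Bool) → ℤ := fun B B' => (doubleCut row col B B' D : ℤ) with hφ
  set cost : Finset (Fin n → Bool) × Finset (Fin n' → Bool) → ℤ := fun p =>
    9 * φ p.1 p.2 + ∑ i : Fin n → Bool, (φ (symmDiff p.1 {i}) p.2 - φ p.1 p.2) +
      ∑ j : Fin n' → Bool, (φ p.1 (symmDiff p.2 {j}) - φ p.1 p.2) with hcost
  -- a pair of minimal cost
  obtain ⟨p₀, -, hmin⟩ := Finset.exists_min_image (Finset.univ : Finset (Finset (Fin n → Bool) × Finset (Fin n' → Bool)))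
    cost Finset.univ_nonempty
  obtain ⟨N, hNr, hNc⟩ := capture_with_slack row col hLC D p₀.1 p₀.2
  refine ⟨p₀.1, p₀.2, N, ?_, hNc⟩
  -- the total cost is `9 Σ Φ`: the slack terms cancel
  have hsum : ∑ p : Finset (Fin n → Bool) × Finset (Fin n' → Bool), cost p =
      9 * ∑ A : Finset (Fin n → Bool), ∑ A' : Finset (Fin n' → Bool), φ A A' := by
    rw [Fintype.sum_prod_type]
    simp only [hcost]
    have h2 : ∑ A : Finset (Fin n → Bool), ∑ A' : Finset (Fin n' → Bool),
        ∑ i : Fin n → Bool, (φ (symmDiff A {i}) A' - φ A A') = 0 := by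
      rw [Finset.sum_comm]
      refine Finset.sum_eq_zero fun A' _ => ?_
      exact sum_sum_slack_eq_zero (fun A => φ A A')
    have h3 : ∑ A : Finset (Fin n → Bool), ∑ A' : Finset (Fin n' → Bool),
        ∑ j : Fin n' → Bool, (φ A (symmDiff A' {j}) - φ A A') = 0 := by
      refine Finset.sum_eq_zero fun A _ => ?_
      exact sum_sum_slack_eq_zero (fun A' => φ A A')
    have split : ∀ A : Finset (Fin n → Bool), ∑ A' : Finset (Fin n' → Bool),
        (9 * φ A A' + ∑ i : Fin n → Bool, (φ (symmDiff A {i}) A' - φ A A') +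
          ∑ j : Fin n' → Bool, (φ A (symmDiff A' {j}) - φ A A')) =
        9 * ∑ A', φ A A' + ∑ A', ∑ i : Fin n → Bool, (φ (symmDiff A {i}) A' - φ A A') +
          ∑ A', ∑ j : Fin n' → Bool, (φ A (symmDiff A' {j}) - φ A A') := by
      intro A
      rw [Finset.sum_add_distrib, Finset.sum_add_distrib, Finset.mul_sum]
    simp only [split]
    rw [Finset.sum_add_distrib, Finset.sum_add_distrib, h2, h3, add_zero, add_zero, Finset.mul_sum]
  -- minimum ≤ average
  have hcard : (Finset.univ : Finset (Finset (Fin n → Bool) × Finset (Fin n' → Bool))).card = 2 ^ (2 ^ n) * 2 ^ (2 ^ n') := by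
    rw [Finset.card_univ, Fintype.card_prod, card_finset_cube, card_finset_cube]
  have havg : ((2 ^ (2 ^ n) * 2 ^ (2 ^ n') : ℕ) : ℤ) * cost p₀ ≤ 9 * ∑ A : Finset (Fin n → Bool), ∑ A' : Finset (Fin n' → Bool), φ A A' := by
    have h := Finset.card_nsmul_le_sum (Finset.univ : Finset (Finset (Fin n → Bool) × Finset (Fin n' → Bool))) cost (cost p₀)
      (fun p _ => hmin p (Finset.mem_univ p))
    rw [hcard, hsum, nsmul_eq_mul] at h
    exact_mod_cast h
  have hφnn : 0 ≤ ∑ A : Finset (Fin n → Bool), ∑ A' : Finset (Fin n' → Bool), φ A A' :=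
    Finset.sum_nonneg fun A _ => Finset.sum_nonneg fun A' _ => by simp [hφ]
  have hN' : (N.rank : ℤ) ≤ cost p₀ := by simpa [hcost, hφ] using hNr
  have hpow : (0 : ℤ) ≤ ((2 ^ (2 ^ n) * 2 ^ (2 ^ n') : ℕ) : ℤ) := by positivity
  have key : ((2 ^ (2 ^ n) * 2 ^ (2 ^ n') : ℕ) : ℤ) * (N.rank : ℤ) ≤
      17 * ∑ A : Finset (Fin n → Bool), ∑ A' : Finset (Fin n' → Bool), φ A A' := by
    calc ((2 ^ (2 ^ n) * 2 ^ (2 ^ n') : ℕ) : ℤ) * (N.rank : ℤ)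
        ≤ ((2 ^ (2 ^ n) * 2 ^ (2 ^ n') : ℕ) : ℤ) * cost p₀ := mul_le_mul_of_nonneg_left hN' hpow
      _ ≤ 9 * ∑ A : Finset (Fin n → Bool), ∑ A' : Finset (Fin n' → Bool), φ A A' := havg
      _ ≤ 17 * ∑ A : Finset (Fin n → Bool), ∑ A' : Finset (Fin n' → Bool), φ A A' := by linarith
  have key' : (((2 ^ (2 ^ n) * 2 ^ (2 ^ n') * N.rank : ℕ)) : ℤ) ≤
      ((17 * ∑ A : Finset (Fin n → Bool), ∑ A' : Finset (Fin n' → Bool), doubleCut row col A A' D : ℕ) : ℤ) := by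
    push_cast
    simpa [hφ, mul_assoc] using key
  exact_mod_cast key'

end Summit.PneNP.PneNP.Theorems.CnfIdealGenLengthRankDefectRepresentationsAverageCapture
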